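import Summits.AtomisticToContinuum.Crystallization.Theorems.PalmUnimodularRigidityMinimiserShellsOfPeriodicShellGap
import Summits.AtomisticToContinuum.Crystallization.Theorems.PalmUnimodularRigidityMinimiserShellsSepQualShellNoBoundaryOfSepPeriodicShellGap
import Summits.AtomisticToContinuum.Crystallization.Theorems.PalmUnimodularRigidityMinimiserShellsSepReductionAssembly

/-!
# Crux `MinimiserShells` (stmt-AtomisticToContinuum-9225) follows from the HARD-CORE periodic shell gap

Line `equilibrium-in-law-surgery`, reshape r6 (lead `…-c3-0`).  Crux decl
`Summit.AtomisticToContinuum.Crystallization.Theses.PalmUnimodularRigidity.MinimiserShells`.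

Reshape r6 adds the hard-core reduction (S15b `SepReduction`, S15d `SepReductionBad`, S15e `SepReductionAssembly`:
energy-minimal sub-configurations of finite near-minimisers are `1/3`-separated, small in complement and keep half of the
badly-shelled sites) and the hard-core periodisation (S16 `SepPeriodicShellGap`).  Composed with r5
(`OfPeriodicShellGap.minimiserShells_of_periodicShellGap`, `periodicShellGap_iff_qualShellNoBoundary`) this file records:

* `minimiserShells_of_sepPeriodicShellGap` : the periodic shell gap RESTRICTED TO `1/3`-SEPARATED periodic configurations
  (the line's residual stub S7⁗ `stub_sepPeriodicShellGap`, OPEN) implies `MinimiserShells`;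
* `periodicShellGap_iff_sepPeriodicShellGap` : the restriction costs nothing — the periodic shell gap (S7‴) is EQUIVALENT to
  its hard-core version (S7⁗);
* `qualShellNoBoundary_iff_sepQualShellNoBoundary` : likewise for the finite no-boundary qualitative shell gap.
So the crux is reduced to ONE statement about uniformly discrete (`1/3`-hard-core) periodic configurations of `ℝ³` — the class
on which Benjamini–Schramm compactness of uniformly rooted blocks is available.
-/

noncomputable section

open MeasureTheory
open scoped ENNReal BigOperators Classical

namespace Summit.AtomisticToContinuum.Crystallization.Theorems.PalmUnimodularRigidityMinimiserShells.OfSepPeriodicShellGap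

open Literature.MathematicalPhysics.StatisticalMechanics (lennardJones interactionEnergy PeriodicConfiguration)
open Summit.AtomisticToContinuum.Crystallization.Theses.PalmUnimodularRigidity (MinimiserShells)
open Summit.AtomisticToContinuum.Crystallization.Theorems.MinimiserShells.Negative.LoadBearing (eStar GoodShell)

/-- **Hard-core periodic shell gap ⇒ `MinimiserShells`** (registered composition marker
`minimiserShells_of_sepPeriodicShellGap`): if for every `t > 0` some `κ > 0` separates from `e*` the energy per particle of
every `1/3`-hard-core periodic configuration with at least `t·#motif` badly-shelled motif sites, then every minimising
point-stationary hard-core law has almost surely a close-packed root shell.  Composition S16 → S15e → (r5: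
S11 → S8b(S8a), `OfPeriodicShellGap.minimiserShells_of_periodicShellGap` through S14). -/
theorem minimiserShells_of_sepPeriodicShellGap :
    (∀ t : ℝ, 0 < t → ∃ κ : ℝ, 0 < κ ∧ ∀ Q : PeriodicConfiguration 3,
      (∀ p ∈ Q.points, ∀ q ∈ Q.points, p ≠ q → (1 : ℝ) / 3 ≤ dist p q) →
      t * (Q.motif.card : ℝ) ≤ (Nat.card {x : Q.motif // ¬ GoodShell
          ((Measure.count : Measure (EuclideanSpace ℝ (Fin 3))).restrict
            ((fun z => z - (x : EuclideanSpace ℝ (Fin 3))) '' Q.points))} : ℝ) →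
      eStar + κ ≤ Q.energyPerParticle lennardJones) →
    MinimiserShells :=
  fun hSep => OfPeriodicShellGap.minimiserShells_of_periodicShellGap
    (PeriodicShellGapConverse.stub_periodicShellGap_of_qualShellNoBoundary
      (SepReductionAssembly.stub_qualShellNoBoundary_of_sepQualShellNoBoundary
        (SepPeriodicShellGap.stub_sepQualShellNoBoundary_of_sepPeriodicShellGap hSep)))

/-- **The finite no-boundary qualitative shell gap is equivalent to its `1/3`-hard-core version** (S15e and the trivial
direction). -/
theorem qualShellNoBoundary_iff_sepQualShellNoBoundary :
    (∀ t : ℝ, 0 < t → ∃ κ : ℝ, 0 < κ ∧ ∀ (N : ℕ) (y : Fin N → EuclideanSpace ℝ (Fin 3)), Function.Injective y →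
      t * (N : ℝ) ≤ (Nat.card {i : Fin N // ¬ GoodShell
          ((Measure.count : Measure (EuclideanSpace ℝ (Fin 3))).restrict ((fun z => z - y i) '' Set.range y))} : ℝ) →
      (N : ℝ) * (eStar + κ) ≤ interactionEnergy lennardJones y) ↔
    (∀ t : ℝ, 0 < t → ∃ κ : ℝ, 0 < κ ∧ ∀ (N : ℕ) (y : Fin N → EuclideanSpace ℝ (Fin 3)), Function.Injective y →
      (∀ i j : Fin N, i ≠ j → (1 : ℝ) / 3 ≤ dist (y i) (y j)) →
      t * (N : ℝ) ≤ (Nat.card {i : Fin N // ¬ GoodShell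
          ((Measure.count : Measure (EuclideanSpace ℝ (Fin 3))).restrict ((fun z => z - y i) '' Set.range y))} : ℝ) →
      (N : ℝ) * (eStar + κ) ≤ interactionEnergy lennardJones y) := by
  constructor
  · intro h t ht
    obtain ⟨κ, hκ, hy⟩ := h t ht
    exact ⟨κ, hκ, fun N y hy' _ hbad => hy N y hy' hbad⟩
  · exact SepReductionAssembly.stub_qualShellNoBoundary_of_sepQualShellNoBoundary

/-- **The periodic shell gap is equivalent to its `1/3`-hard-core version** (S7‴ ⇔ S7⁗): `→` is the trivial restriction,
`←` is S16 → S15e → S14. -/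
theorem periodicShellGap_iff_sepPeriodicShellGap :
    (∀ t : ℝ, 0 < t → ∃ κ : ℝ, 0 < κ ∧ ∀ Q : PeriodicConfiguration 3,
      t * (Q.motif.card : ℝ) ≤ (Nat.card {x : Q.motif // ¬ GoodShell
          ((Measure.count : Measure (EuclideanSpace ℝ (Fin 3))).restrict
            ((fun z => z - (x : EuclideanSpace ℝ (Fin 3))) '' Q.points))} : ℝ) →
      eStar + κ ≤ Q.energyPerParticle lennardJones) ↔
    (∀ t : ℝ, 0 < t → ∃ κ : ℝ, 0 < κ ∧ ∀ Q : PeriodicConfiguration 3,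
      (∀ p ∈ Q.points, ∀ q ∈ Q.points, p ≠ q → (1 : ℝ) / 3 ≤ dist p q) →
      t * (Q.motif.card : ℝ) ≤ (Nat.card {x : Q.motif // ¬ GoodShell
          ((Measure.count : Measure (EuclideanSpace ℝ (Fin 3))).restrict
            ((fun z => z - (x : EuclideanSpace ℝ (Fin 3))) '' Q.points))} : ℝ) →
      eStar + κ ≤ Q.energyPerParticle lennardJones) := by
  constructor
  · intro h t ht
    obtain ⟨κ, hκ, hQ⟩ := h t ht
    exact ⟨κ, hκ, fun Q _ hbad => hQ Q hbad⟩
  · intro hSep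
    exact PeriodicShellGapConverse.stub_periodicShellGap_of_qualShellNoBoundary
      (SepReductionAssembly.stub_qualShellNoBoundary_of_sepQualShellNoBoundary
        (SepPeriodicShellGap.stub_sepQualShellNoBoundary_of_sepPeriodicShellGap hSep))

end Summit.AtomisticToContinuum.Crystallization.Theorems.PalmUnimodularRigidityMinimiserShells.OfSepPeriodicShellGap

end
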